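/-
Copyright: the b2b-balaban T⁴-continuum CRUX team, row NE7b OWNER lineage `t4-ne7b-p1` (gen 135). Project licence.
-/
import Summits.QuantumFields.BalabanUV.T4Continuum.Spine.NE7b.SupNextSingletonRegulated
import Summits.QuantumFields.BalabanUV.T4Continuum.Spine.NE7b.SupRoadSupportTermMeasurable

/-!
# THE NEXT SINGLETON FACTORS IN THE INPUT FORMAT — REGULATED, LOCAL, CELL-MEASURABLE ON THE NEXT CELLS: for the road's input class on a
# family `𝒳` (members `R`-connected, factors `f_X` cell-measurable, LOCAL in the field, singletons regulated `(ε, κ)`, larger sets sup-small)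
# over the Gaussian road `N(0,Γ)` and blocks `blk p'` of `≤ b` cells with next cells `cell' p' := ⋃_{p∈blk p'}cell p`, the UNEXPANDED next
# singleton factor `g⁺_{p'}(ψ) := Z_ψ(𝒳|_{blk p'}) − 1 = ∫∏_{X∈𝒳, X⊆blk p'}(1 + f_X(ω+ψ))dN(0,Γ)(ω) − 1` satisfies the THREE singleton
# hypotheses of (355)'s step at the next scale:
#  (reg)  `‖g⁺_{p'}(ψ)‖ ≤ ε⁺·e^{½κ⁺Σ_{x∈cell' p'}ψ_x²}` for EVERY `ψ`, ONE `ε⁺ = max(2η_b, (1 + e^{(1+ε)^b}A_τ^{vb})e^{−(κ⁺−κ₁)Ψ²∕2})` for all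
#         blocks ((371) BY NAME with `S ≤ e^{(1+ε)^b}`, `A_τ^{#cells} ≤ A_τ^{vb}`, `η_D ≤ η_b`);
#  (loc)  `ψ = ψ'` on `cell' p'` ⟹ `g⁺_{p'}(ψ) = g⁺_{p'}(ψ')` (no smallness, any measure);
#  (meas) `ψ ↦ g⁺_{p'}(ψ)` is measurable for `σ(ψ|_{cell' p'})` — Fubini's measurability half + locality + the measurable cut-off, and the
#         comparison `⨆_{p∈D}σ(ψ|_{cell p}) ≤ σ(ψ|_{⋃_{p∈D}cell p})` —
# so the singleton part of the polymer-local class is CLOSED IN FORMAT INCLUDING LARGE FIELDS (SCOPING-d6′ (L4) done; row NE7b, node U5c; [folklore])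

Cell `pub-balaban`, sub-cell `t4`, spine estimate NE7b (`T4WeightBudget.RelWeightBound`; the cell's OWN estimate — NOT PRINTED in
[Bałaban 1983–89], NOT PROVED).  Crux-route work under `Spine/NE7b/` by the row OWNER (`t4-ne7b-p1` gen 135, file (372)) under FREEZE
(0)'s crux-prover clause, on `g134/records/SCOPING-d6-iteration.md` DECISION (d6′)(1)–(2); NOTHING of Bałaban's is named as a Lean object, valued
or asserted; no `T4Continuum/Support` leaf typed; no `def`, no notation; zero `sorry`.  Imports (BY NAME): the OWNER's (371) `…SupNextSingletonRegulated`
(`norm_pertZ_shifted_sub_one_le_regulated`, `prod_one_add_pow_le_exp`), (370) `…SupRoadSupportTermMeasurable` (`measurable_cutoffField`), (363)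
(`cutoffField_eq_on`), (289) (`one_le_regulatorCost`, `card_biUnion_cell_le`); Mathlib's `StronglyMeasurable.integral_prod_right`,
`MeasurableSpace.comap_comp`, `measurable_pi_lambda`.

WHAT IS PROVED ([folklore]; `Z_ψ(𝒜) := pertZ N(0,Γ) (X ω ↦ f_X(ω+ψ)) 𝒜`, `𝒳|_D := {X ∈ 𝒳 : X ⊆ D}`):
* §1 (reg) **`nextSingleton_regulated`** (the displayed all-`ψ` regulated letter on the next cells, one constant for all blocks of `≤ b` cells);
* §2 (loc) `pertZ_shifted_local` (fields equal on the cells of `⋃𝒜`), **`nextSingleton_local`** (fields equal on the cells of the block);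
* §3 (meas) `measurable_of_cells` (join-measurable ⟹ Borel), **`measurable_pertZ_shifted`** (`ψ ↦ Z_ψ(𝒜)` Borel-measurable: parametric integral),
  **`measurable_pertZ_shifted_cells`** (measurable for `⨆_{p∈D}σ(ψ|_{cell p})` when the members lie in `D`: locality + cut-off),
  `comap_cell_le_comap_biUnion` ∕ `iSup_comap_cells_le` (`σ(ψ|_{cell p}) ≤ σ(ψ|_{⋃_D cell})` for `p ∈ D`, hence the join), THE END
  **`measurable_nextSingleton_cells`** (`ψ ↦ g⁺_{p'}(ψ)` measurable for `σ(ψ|_{cell' p'})`, and for the join `⨆_{q∈X'}σ(ψ|_{cell' q})` of any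
  next cell set `X' ∋ p'` — literally (355)'s `hmeas` at the next scale); §4 toy.

HONEST (what this is NOT).  Format bookkeeping for the SINGLETON part of the next input class; the non-singleton next factors keep (363)'s sup letter on
their small-field region and (361)'s pinned norm (their all-`ψ` letter is the large-field REGION bookkeeping (335)∕(343), not a sup letter); the
identification `Σ_{∅≠Y⊆blk p'}K⁺_Y(ψ) = log Z_ψ(𝒳|_{blk p'})` at small `ψ` (the blocked singleton term of (367) is the logarithm of THIS factor) is the
successor file; the regulator-rate price `κ⁺ > 2κ₁` of (371) stands (NC-NE7b-α's rescaling regenerates it — untouched); scalar skeleton ((A3),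
NC-NE7b-α UNRULED); nothing of Bałaban's asserted.  BY-NAME EFFECT ON THE WALL: NONE.  NE7b NOT PRINTED ∕ NOT PROVED; spine PROVED 0∕9; rung (B)+1 —
the programme's measures remain FINITE-torus statements; NOT the mass gap, NOT Clay.  HONEST DEPENDENCY: continuum YM on T⁴ ⇐ BetaPertH ∧ nine spine
estimates (0∕9 proved); BetaPertH ⇐ (D1) ∧ (D4) ∧ CAP+tail; G-an2-4 gates asym, D1 and NE2∕3∕4.
-/

set_option autoImplicit false

noncomputable section

namespace Summit.QuantumFields.BalabanUV.T4Continuum.NE7b.SupNextSingletonFormat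

open MeasureTheory ProbabilityTheory Finset Real
open scoped BigOperators
open Literature.Probability.LatticeModels
open Literature.Analysis.Matrix (HasFiniteRange)
open SupNextSingletonRegulated (norm_pertZ_shifted_sub_one_le_regulated prod_one_add_pow_le_exp)
open SupRoadSupportTermMeasurable (measurable_cutoffField)
open SupOutputSmallFieldLetter (cutoffField_eq_on)
open SupRegulatedActivityBound (one_le_regulatorCost card_biUnion_cell_le)

variable {V : Type*} [DecidableEq V] {R : V → V → Prop} [DecidableRel R] {nbr : V → Finset V} {Δ : ℕ}
variable {ι : Type} [Fintype ι] [DecidableEq ι]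

/-! ## §1. (reg) The next singleton factors are regulated on the next cells, uniformly in the block -/

/-- **THE END IN (289)'s FORMAT — THE NEXT SINGLETON FACTORS ARE REGULATED `(ε⁺, κ⁺)` ON THE NEXT CELLS, UNIFORMLY IN THE BLOCK.**  The road's
input class on a family `𝒳` (members `R`-connected, factors cell-measurable, singletons regulated `(ε, κ)` with `0 < ε`, the others sup-small)
over the Gaussian road; blocks `blk p'` of `≤ b` cells; a next rate `κ⁺ ≥ κ₁ = κ(1+τ⁻¹)`; `e·ε₁·(Δ+1)² ≤ 1∕2` and `η_b := b(Δ+1)2e·ε₁ ≤ 1∕2` ⟹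
for EVERY block `p'` and EVERY `ψ`, the next singleton factor `g⁺_{p'}(ψ) = Z_ψ(𝒳|_{blk p'}) − 1` obeys
`‖g⁺_{p'}(ψ)‖ ≤ ε⁺·e^{½κ⁺Σ_{x∈cell' p'}ψ_x²}`, `cell' p' = ⋃_{p∈blk p'}cell p`,
`ε⁺ = max(2η_b, (1 + e^{(1+ε)^b}·A_τ^{vb})·e^{−(κ⁺−κ₁)Ψ²∕2})` — ONE constant for all blocks. [folklore] -/
theorem nextSingleton_regulated {Γ : Matrix ι ι ℝ} {γop γ : ℝ} (hΓ : Γ.PosSemidef)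
    (hΓop : (γop • (1 : Matrix ι ι ℝ) - Γ).PosSemidef) (hdiag : ∀ i, Γ i i ≤ γ) (hγ : 0 ≤ γ) {dι : ι → ι → ℕ} {ρ : ℕ}
    (hfr : HasFiniteRange dι ρ Γ) (cell : V → Finset ι) (hdisj : ∀ p q, p ≠ q → Disjoint (cell p) (cell q)) {v : ℕ}
    (hv : ∀ p, (cell p).card ≤ v) (hRsymm : ∀ x y, R x y → R y x)
    (hR : ∀ (p p' : V) (x y : ι), x ∈ cell p → y ∈ cell p' → dι x y ≤ ρ → p = p' ∨ R p p')
    (hΔ : ∀ x, (nbr x).card ≤ Δ) (hnbr : ∀ x y, R x y → y ∈ nbr x)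
    {f : Finset V → EuclideanSpace ℝ ι → ℂ} {ε κ τ θ Ψ : ℝ} (hε : 0 < ε) (hκ : 0 ≤ κ) (hτ : 0 < τ) (hθ0 : 0 < θ) (hθ1 : θ < 1)
    (hκθ : κ * (1 + τ) * γop ≤ θ) (𝒳 : Finset (Finset V)) (hconn : ∀ X ∈ 𝒳, IsRConnected R X)
    (hmeas : ∀ X ∈ 𝒳, Measurable[⨆ p ∈ X, MeasurableSpace.comap (fun (ω : EuclideanSpace ℝ ι) (x : cell p) => ω x) inferInstance] (f X))
    (hreg : ∀ X ∈ 𝒳, X.card = 1 → ∀ ω : EuclideanSpace ℝ ι, ‖f X ω‖ ≤ ε ^ X.card * exp (κ * (∑ x ∈ X.biUnion cell, ω x ^ 2) / 2))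
    (hsup : ∀ X ∈ 𝒳, X.card ≠ 1 → ∀ ω : EuclideanSpace ℝ ι, ‖f X ω‖ ≤ ε ^ X.card) {W : Type*} (blk : W → Finset V) {b : ℕ}
    (hb : ∀ p', (blk p').card ≤ b) {κ' : ℝ} (hκ' : κ * (1 + τ⁻¹) ≤ κ')
    (hsmall : Real.exp 1 * (2 * Real.exp 1 * ((Δ : ℝ) + 1) ^ 2 *
      ((ε * exp (κ * (1 + τ⁻¹) * Ψ ^ 2 / 2)) * ((1 - θ) ^ (-(κ * (1 + τ) * γ / (2 * θ)))) ^ v)) * ((Δ : ℝ) + 1) ^ 2 ≤ 1 / 2)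
    (hη : (b : ℝ) * ((Δ : ℝ) + 1) * (2 * (Real.exp 1 * (2 * Real.exp 1 * ((Δ : ℝ) + 1) ^ 2 *
      ((ε * exp (κ * (1 + τ⁻¹) * Ψ ^ 2 / 2)) * ((1 - θ) ^ (-(κ * (1 + τ) * γ / (2 * θ)))) ^ v)))) ≤ 1 / 2)
    (p' : W) (ψ : EuclideanSpace ℝ ι) :
    ‖pertZ (multivariateGaussian 0 Γ) (fun X ω => f X (ω + ψ)) (𝒳.filter fun X => X ⊆ blk p') - 1‖ ≤
      max (2 * ((b : ℝ) * ((Δ : ℝ) + 1) * (2 * (Real.exp 1 * (2 * Real.exp 1 * ((Δ : ℝ) + 1) ^ 2 *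
              ((ε * exp (κ * (1 + τ⁻¹) * Ψ ^ 2 / 2)) * ((1 - θ) ^ (-(κ * (1 + τ) * γ / (2 * θ)))) ^ v))))))
          ((1 + Real.exp ((1 + ε) ^ b) * (((1 - θ) ^ (-(κ * (1 + τ) * γ / (2 * θ)))) ^ v) ^ b) *
            Real.exp (-((κ' - κ * (1 + τ⁻¹)) * Ψ ^ 2 / 2))) *
        exp (κ' * (∑ x ∈ (blk p').biUnion cell, ψ x ^ 2) / 2) := by
  set 𝒜 := 𝒳.filter fun X => X ⊆ blk p' with h𝒜
  set e1 : ℝ := Real.exp 1 * (2 * Real.exp 1 * ((Δ : ℝ) + 1) ^ 2 *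
    ((ε * exp (κ * (1 + τ⁻¹) * Ψ ^ 2 / 2)) * ((1 - θ) ^ (-(κ * (1 + τ) * γ / (2 * θ)))) ^ v)) with he1
  set A : ℝ := (1 - θ) ^ (-(κ * (1 + τ) * γ / (2 * θ))) with hA
  have h𝒜D : ∀ X ∈ 𝒜, X ⊆ blk p' := fun X hX => (mem_filter.1 hX).2
  have h𝒜𝒳 : ∀ X ∈ 𝒜, X ∈ 𝒳 := fun X hX => (mem_filter.1 hX).1
  have hκγ : 0 ≤ κ * (1 + τ) * γ := by positivity
  have hA1 : 1 ≤ A := one_le_regulatorCost hκγ hθ0 hθ1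
  have he1_0 : 0 ≤ e1 := by positivity
  -- `#(⋃𝒜) ≤ #blk p' ≤ b`, so `η_D ≤ η_b`
  have hUb : ((𝒜.biUnion id).card : ℝ) ≤ b := by
    have h1 : 𝒜.biUnion id ⊆ blk p' := biUnion_subset.2 fun X hX => by simpa using h𝒜D X hX
    exact_mod_cast (card_le_card h1).trans (hb p')
  have hηD : (𝒜.biUnion id).card * ((Δ : ℝ) + 1) * (2 * e1) ≤ (b : ℝ) * ((Δ : ℝ) + 1) * (2 * e1) := by gcongr
  -- `S ≤ e^{(1+ε)^b}` and `A^{#cells(blk p')} ≤ (A^v)^b`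
  have hS : ∏ X ∈ 𝒜, (1 + ε ^ X.card) ≤ Real.exp ((1 + ε) ^ b) :=
    (prod_one_add_pow_le_exp hε.le h𝒜D).trans (exp_le_exp.2 (pow_le_pow_right₀ (by linarith [hε.le]) (hb p')))
  have hAD : A ^ ((blk p').biUnion cell).card ≤ (A ^ v) ^ b := by
    rw [← pow_mul]
    exact pow_le_pow_right₀ hA1 ((card_biUnion_cell_le cell hv (blk p')).trans (Nat.mul_le_mul_left v (hb p')))
  have hSA : (∏ X ∈ 𝒜, (1 + ε ^ X.card)) * A ^ ((blk p').biUnion cell).card ≤ Real.exp ((1 + ε) ^ b) * (A ^ v) ^ b :=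
    mul_le_mul hS hAD (pow_nonneg (zero_le_one.trans hA1) _) (exp_pos _).le
  have key := norm_pertZ_shifted_sub_one_le_regulated hΓ hΓop hdiag hγ hfr cell hdisj hv hRsymm hR hΔ hnbr hε hκ hτ hθ0 hθ1 hκθ 𝒜
    (fun X hX => hconn X (h𝒜𝒳 X hX)) h𝒜D (fun X hX => hmeas X (h𝒜𝒳 X hX)) (fun X hX => hreg X (h𝒜𝒳 X hX))
    (fun X hX => hsup X (h𝒜𝒳 X hX)) hκ' hsmall (hηD.trans hη) ψ
  refine key.trans (mul_le_mul_of_nonneg_right (max_le_max (by linarith) ?_) (exp_pos _).le)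
  exact mul_le_mul_of_nonneg_right (by linarith) (exp_pos _).le

/-! ## §2. (loc) Locality in the external field -/

omit [DecidableRel R] [Fintype ι] [DecidableEq ι] in
/-- **THE NEXT SINGLE-BLOCK FACTOR IS LOCAL IN THE EXTERNAL FIELD**: factors local in the field on their sets ⟹ two fields equal on the cells
of `⋃𝒜` give the same `Z_ψ(𝒜)` (no smallness, any measure). [folklore] -/
theorem pertZ_shifted_local (μ : Measure (EuclideanSpace ℝ ι)) (cell : V → Finset ι) {f : Finset V → EuclideanSpace ℝ ι → ℂ}
    (𝒜 : Finset (Finset V))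
    (hloc : ∀ X ∈ 𝒜, ∀ (ω ψ ψ' : EuclideanSpace ℝ ι), (∀ p ∈ X, ∀ x ∈ cell p, ψ x = ψ' x) → f X (ω + ψ) = f X (ω + ψ'))
    {ψ ψ' : EuclideanSpace ℝ ι} (hagree : ∀ p ∈ 𝒜.biUnion id, ∀ x ∈ cell p, ψ x = ψ' x) :
    pertZ μ (fun X ω => f X (ω + ψ)) 𝒜 = pertZ μ (fun X ω => f X (ω + ψ')) 𝒜 := by
  unfold pertZ
  refine integral_congr_ae (ae_of_all _ fun ω => prod_congr rfl fun X hX => ?_)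
  exact congrArg (fun z : ℂ => 1 + z)
    (hloc X hX ω ψ ψ' fun p hp x hx => hagree p (mem_biUnion.2 ⟨X, hX, by simpa using hp⟩) x hx)

omit [DecidableRel R] [Fintype ι] [DecidableEq ι] in
/-- … in particular two fields equal on the cells of the BLOCK give the same next singleton factor. [folklore] -/
theorem nextSingleton_local (μ : Measure (EuclideanSpace ℝ ι)) (cell : V → Finset ι) {f : Finset V → EuclideanSpace ℝ ι → ℂ}
    (𝒳 : Finset (Finset V))
    (hloc : ∀ X ∈ 𝒳, ∀ (ω ψ ψ' : EuclideanSpace ℝ ι), (∀ p ∈ X, ∀ x ∈ cell p, ψ x = ψ' x) → f X (ω + ψ) = f X (ω + ψ'))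
    (D : Finset V) {ψ ψ' : EuclideanSpace ℝ ι} (hagree : ∀ p ∈ D, ∀ x ∈ cell p, ψ x = ψ' x) :
    pertZ μ (fun X ω => f X (ω + ψ)) (𝒳.filter fun X => X ⊆ D) = pertZ μ (fun X ω => f X (ω + ψ')) (𝒳.filter fun X => X ⊆ D) := by
  refine pertZ_shifted_local μ cell _ (fun X hX => hloc X (mem_filter.1 hX).1) fun p hp x hx => hagree p ?_ x hx
  obtain ⟨X, hX, hpX⟩ := mem_biUnion.1 hp
  exact (mem_filter.1 hX).2 (by simpa using hpX)

/-! ## §3. (meas) Measurability in the external field, and in the next cells -/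

omit [DecidableEq V] [DecidableRel R] [Fintype ι] [DecidableEq ι] in
/-- **Join-measurable factors are Borel-measurable** (the cell σ-algebras are sub-σ-algebras of the Borel one). [folklore] -/
theorem measurable_of_cells (cell : V → Finset ι) {g : EuclideanSpace ℝ ι → ℂ} {X : Finset V}
    (hmeas : Measurable[⨆ p ∈ X, MeasurableSpace.comap (fun (ω : EuclideanSpace ℝ ι) (x : cell p) => ω x) inferInstance] g) :
    Measurable g :=
  hmeas.mono (iSup₂_le fun p _ => measurable_iff_comap_le.1 (by fun_prop)) le_rfl

omit [DecidableEq V] [DecidableRel R] [DecidableEq ι] in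
/-- **`ψ ↦ Z_ψ(𝒜)` IS BOREL-MEASURABLE** (Fubini's measurability half): factors of `𝒜` Borel-measurable, `μ` s-finite. [folklore] -/
theorem measurable_pertZ_shifted (μ : Measure (EuclideanSpace ℝ ι)) [SFinite μ] {f : Finset V → EuclideanSpace ℝ ι → ℂ}
    (𝒜 : Finset (Finset V)) (hf : ∀ X ∈ 𝒜, Measurable (f X)) :
    Measurable fun ψ : EuclideanSpace ℝ ι => pertZ μ (fun X ω => f X (ω + ψ)) 𝒜 := by
  unfold pertZ
  have hF : Measurable (Function.uncurry fun (ψ : EuclideanSpace ℝ ι) (ω : EuclideanSpace ℝ ι) => ∏ X ∈ 𝒜, (1 + f X (ω + ψ))) :=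
    Finset.measurable_prod _ fun X hX => measurable_const.add ((hf X hX).comp (measurable_snd.add measurable_fst))
  exact (hF.stronglyMeasurable.integral_prod_right (ν := μ)).measurable

omit [DecidableRel R] in
/-- **`ψ ↦ Z_ψ(𝒜)` IS MEASURABLE IN THE CELLS OF ANY `D` CONTAINING THE MEMBERS**: factors Borel-measurable and LOCAL in the field, `μ` s-finite,
members of `𝒜` inside `D` ⟹ measurable for `⨆_{p∈D}σ(ψ|_{cell p})` (`Z_ψ = Z_{ψ^D}` by locality; `ψ ↦ ψ^D` is measurable from the join, (370)). [folklore] -/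
theorem measurable_pertZ_shifted_cells (μ : Measure (EuclideanSpace ℝ ι)) [SFinite μ] (cell : V → Finset ι)
    {f : Finset V → EuclideanSpace ℝ ι → ℂ} (𝒜 : Finset (Finset V)) (hf : ∀ X ∈ 𝒜, Measurable (f X))
    (hloc : ∀ X ∈ 𝒜, ∀ (ω ψ ψ' : EuclideanSpace ℝ ι), (∀ p ∈ X, ∀ x ∈ cell p, ψ x = ψ' x) → f X (ω + ψ) = f X (ω + ψ'))
    {D : Finset V} (h𝒜D : ∀ X ∈ 𝒜, X ⊆ D) :
    Measurable[⨆ p ∈ D, MeasurableSpace.comap (fun (ω : EuclideanSpace ℝ ι) (x : cell p) => ω x) inferInstance]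
      (fun ψ : EuclideanSpace ℝ ι => pertZ μ (fun X ω => f X (ω + ψ)) 𝒜) := by
  have hfun : (fun ψ : EuclideanSpace ℝ ι => pertZ μ (fun X ω => f X (ω + ψ)) 𝒜) =
      (fun φ : EuclideanSpace ℝ ι => pertZ μ (fun X ω => f X (ω + φ)) 𝒜) ∘
      (fun ψ : EuclideanSpace ℝ ι => (WithLp.toLp 2 (fun x => if x ∈ D.biUnion cell then ψ x else 0) : EuclideanSpace ℝ ι)) := by
    funext ψ
    refine pertZ_shifted_local μ cell 𝒜 hloc fun p hp x hx => cutoffField_eq_on cell D ψ p ?_ x hx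
    obtain ⟨X, hX, hpX⟩ := mem_biUnion.1 hp
    exact h𝒜D X hX (by simpa using hpX)
  rw [hfun]
  exact (measurable_pertZ_shifted μ 𝒜 hf).comp (measurable_cutoffField cell D)

omit [DecidableEq V] [DecidableRel R] [Fintype ι] in
/-- **One cell's σ-algebra lies below the σ-algebra of the block's cells**: `p ∈ D` ⟹ `σ(ψ|_{cell p}) ≤ σ(ψ|_{⋃_{q∈D}cell q})` (the restriction to
`cell p` factors measurably through the restriction to the larger index set). [folklore] -/
theorem comap_cell_le_comap_biUnion (cell : V → Finset ι) {D : Finset V} {p : V} (hp : p ∈ D) :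
    MeasurableSpace.comap (fun (ω : EuclideanSpace ℝ ι) (x : cell p) => ω x) inferInstance ≤
      MeasurableSpace.comap (fun (ω : EuclideanSpace ℝ ι) (x : D.biUnion cell) => ω x) (inferInstance : MeasurableSpace (D.biUnion cell → ℝ)) := by
  have hsub : ∀ x : cell p, (x : ι) ∈ D.biUnion cell := fun x => mem_biUnion.2 ⟨p, hp, x.2⟩
  set proj : (D.biUnion cell → ℝ) → (cell p → ℝ) := fun g x => g ⟨x, hsub x⟩ with hproj
  have hprojm : Measurable proj := measurable_pi_lambda _ fun x => measurable_pi_apply _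
  have hcomp : (fun (ω : EuclideanSpace ℝ ι) (x : cell p) => ω x) = proj ∘ (fun (ω : EuclideanSpace ℝ ι) (x : D.biUnion cell) => ω x) := by
    funext ω; rfl
  rw [hcomp, ← MeasurableSpace.comap_comp]
  exact MeasurableSpace.comap_mono (measurable_iff_comap_le.1 hprojm)

omit [DecidableEq V] [DecidableRel R] [Fintype ι] in
/-- … hence the JOIN over the block lies below it: `⨆_{p∈D}σ(ψ|_{cell p}) ≤ σ(ψ|_{⋃_{q∈D}cell q})`. [folklore] -/
theorem iSup_comap_cells_le (cell : V → Finset ι) (D : Finset V) :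
    (⨆ p ∈ D, MeasurableSpace.comap (fun (ω : EuclideanSpace ℝ ι) (x : cell p) => ω x) inferInstance) ≤
      MeasurableSpace.comap (fun (ω : EuclideanSpace ℝ ι) (x : D.biUnion cell) => ω x) (inferInstance : MeasurableSpace (D.biUnion cell → ℝ)) :=
  iSup₂_le fun _ hp => comap_cell_le_comap_biUnion cell hp

omit [DecidableRel R] in
/-- **THE END (meas) — THE NEXT SINGLETON FACTOR IS MEASURABLE IN ITS NEXT CELL**: the road's factors cell-measurable and local in the field ⟹ for
`cell' p' = ⋃_{p∈blk p'}cell p`, `ψ ↦ Z_ψ(𝒳|_{blk p'}) − 1` is measurable for `σ(ψ|_{cell' p'})`. [folklore] -/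
theorem measurable_nextSingleton_cell (cell : V → Finset ι) {f : Finset V → EuclideanSpace ℝ ι → ℂ} (𝒳 : Finset (Finset V))
    (hmeas : ∀ X ∈ 𝒳, Measurable[⨆ p ∈ X, MeasurableSpace.comap (fun (ω : EuclideanSpace ℝ ι) (x : cell p) => ω x) inferInstance] (f X))
    (hloc : ∀ X ∈ 𝒳, ∀ (ω ψ ψ' : EuclideanSpace ℝ ι), (∀ p ∈ X, ∀ x ∈ cell p, ψ x = ψ' x) → f X (ω + ψ) = f X (ω + ψ'))
    (Γ : Matrix ι ι ℝ) {W : Type*} (blk : W → Finset V) (p' : W) :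
    Measurable[MeasurableSpace.comap (fun (ω : EuclideanSpace ℝ ι) (x : (blk p').biUnion cell) => ω x) inferInstance]
      (fun ψ : EuclideanSpace ℝ ι => pertZ (multivariateGaussian 0 Γ) (fun X ω => f X (ω + ψ)) (𝒳.filter fun X => X ⊆ blk p') - 1) := by
  have h := measurable_pertZ_shifted_cells (multivariateGaussian 0 Γ) cell (𝒳.filter fun X => X ⊆ blk p')
    (fun X hX => measurable_of_cells cell (hmeas X (mem_filter.1 hX).1)) (fun X hX => hloc X (mem_filter.1 hX).1)
    (D := blk p') (fun X hX => (mem_filter.1 hX).2)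
  exact (h.mono (iSup_comap_cells_le cell (blk p')) le_rfl).sub measurable_const

omit [DecidableRel R] in
/-- **… and for the join over any next cell set containing `p'`** — literally (355)'s `hmeas` at the next scale for the singleton `X' = {p'}` (or any
`X' ∋ p'`). [folklore] -/
theorem measurable_nextSingleton_cells (cell : V → Finset ι) {f : Finset V → EuclideanSpace ℝ ι → ℂ} (𝒳 : Finset (Finset V))
    (hmeas : ∀ X ∈ 𝒳, Measurable[⨆ p ∈ X, MeasurableSpace.comap (fun (ω : EuclideanSpace ℝ ι) (x : cell p) => ω x) inferInstance] (f X))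
    (hloc : ∀ X ∈ 𝒳, ∀ (ω ψ ψ' : EuclideanSpace ℝ ι), (∀ p ∈ X, ∀ x ∈ cell p, ψ x = ψ' x) → f X (ω + ψ) = f X (ω + ψ'))
    (Γ : Matrix ι ι ℝ) {W : Type*} (blk : W → Finset V) {X' : Finset W} {p' : W} (hp' : p' ∈ X') :
    Measurable[⨆ q ∈ X', MeasurableSpace.comap (fun (ω : EuclideanSpace ℝ ι) (x : (blk q).biUnion cell) => ω x) inferInstance]
      (fun ψ : EuclideanSpace ℝ ι => pertZ (multivariateGaussian 0 Γ) (fun X ω => f X (ω + ψ)) (𝒳.filter fun X => X ⊆ blk p') - 1) :=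
  (measurable_nextSingleton_cell cell 𝒳 hmeas hloc Γ blk p').mono
    (le_iSup₂ (f := fun q (_ : q ∈ X') => MeasurableSpace.comap (fun (ω : EuclideanSpace ℝ ι) (x : (blk q).biUnion cell) => ω x)
      inferInstance) p' hp') le_rfl

/-! ## §4. Toy -/

omit [DecidableRel R] [Fintype ι] in
/-- Toy (§3): for the EMPTY block the join over no cells is `⊥ ≤` anything. -/
example (cell : V → Finset ι) :
    (⨆ p ∈ (∅ : Finset V), MeasurableSpace.comap (fun (ω : EuclideanSpace ℝ ι) (x : cell p) => ω x) inferInstance) ≤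
      MeasurableSpace.comap (fun (ω : EuclideanSpace ℝ ι) (x : (∅ : Finset V).biUnion cell) => ω x)
        (inferInstance : MeasurableSpace ((∅ : Finset V).biUnion cell → ℝ)) :=
  iSup_comap_cells_le cell ∅

end Summit.QuantumFields.BalabanUV.T4Continuum.NE7b.SupNextSingletonFormat
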